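import Mathlib.RingTheory.MvPolynomial.WeightedHomogeneous
import Mathlib.Algebra.MvPolynomial.Eval
import Mathlib.LinearAlgebra.Span.Basic
import HarnessLib

/-!
# Set-multilinear polynomials and set-multilinear projections

(Limaye–Srinivasan–Tavenas, *Superpolynomial lower bounds against low-depth algebraic circuits*,
J. ACM 72 (2025), Art. 26 = FOCS 2021, §2 and §3.)

Fix a *block map* `blk : σ → ι` partitioning the variables `σ` into blocks `X_i = blk ⁻¹ {i}`
(LST, §2: "a tuple of sets of variables `(X_1, …, X_d)`"). A monomial `m` is *set-multilinear over*
a finite set `S` of blocks if it has degree exactly `1` in the variables of each block `i ∈ S` and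
degree `0` in all other blocks; a polynomial is set-multilinear over `S` if all its monomials are
(LST, §2, `F_sm[X(w|_S)]`). The *set-multilinear projection* `smlProj blk S f` keeps exactly the
monomials of `f` that are set-multilinear over `S` (LST, proof of Lemma 12, p. 26:11: the gate
`α_S` computes "the projection of the polynomial computed by `α` to the set-multilinear part
associated to `S`").

## Design

* Everything is an instance of Mathlib's weighted-homogeneity API: the *block weight* of a
  variable `v` is `Finsupp.single (blk v) 1 : ι →₀ ℕ`, so the weighted degree
  `Finsupp.weight (blockWeight blk) m` of a monomial `m` is its *block-degree vector*, and `m` is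
  set-multilinear over `S` iff this vector is the indicator `blockProfile S = ∑ i ∈ S, single i 1`.
  Hence `IsSetMultilinear blk S f := IsWeightedHomogeneous (blockWeight blk) f (blockProfile S)`
  and `smlProj blk S := weightedHomogeneousComponent (blockWeight blk) (blockProfile S)`, and
  linearity, idempotence, closure under products (`IsWeightedHomogeneous.mul`) come for free.
* Proved here (not in Mathlib): the product formula
  `smlProj S (f * g) = ∑ S₁ ∈ S.powerset, smlProj S₁ f * smlProj (S \ S₁) g` (the identity
  behind LST's Lemma 12: a set-multilinear monomial over `S` factors uniquely as a product of
  set-multilinear monomials over complementary subsets), its `n`-ary span form for a list of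
  factors (generators indexed by maps `↥S → Fin n`, i.e. labelled ordered partitions of `S`, so
  that there are `n ^ #S` of them), the vanishing of `smlProj S` on products of more than `#S`
  factors without constant term, and the fact that block-preserving algebra homomorphisms
  (substitutions of each variable by a form that is block-linear in the corresponding block)
  commute with `smlProj`.
* No circuits here; this file is pure commutative algebra over a commutative semiring `R`.

## References

* N. Limaye, S. Srinivasan, S. Tavenas, J. ACM 72 (2025), Art. 26, §2 (set-multilinear
  polynomials `F_sm[X(w)]`), §3, Lemma 12 (projection to the set-multilinear part `α_S`).
-/

noncomputable section

open MvPolynomial Finsupp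

namespace Literature.Computability.AlgebraicComplexity

universe u v w

variable {R : Type u} [CommSemiring R] {σ : Type v} {ι : Type w}

/-! ### Block weights, block-degree vectors and block profiles -/

/-- The *block weight* of the variables for a block map `blk : σ → ι`: the variable `v` weighs
the unit vector at its block `blk v`. The weighted degree `Finsupp.weight (blockWeight blk) m` of a
monomial `m` is then its vector of degrees in the blocks (LST 2025, §2, degree of a monomial in
each variable set `X_i`). [cite: LimayeSrinivasanTavenas2025, §2] -/
def blockWeight (blk : σ → ι) : σ → (ι →₀ ℕ) := fun v => Finsupp.single (blk v) 1

/-- The *block profile* of a finite set `S` of blocks: the indicator vector `∑ i ∈ S, single i 1`.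
A monomial is set-multilinear over `S` iff its block-degree vector is `blockProfile S`
(LST 2025, §2). [cite: LimayeSrinivasanTavenas2025, §2] -/
def blockProfile (S : Finset ι) : ι →₀ ℕ := ∑ i ∈ S, Finsupp.single i 1

/-- `f` is *set-multilinear over the blocks `S`* (w.r.t. `blk`): every monomial of `f` has degree
exactly `1` in each block `i ∈ S` and degree `0` in every other block, i.e. `f ∈ F_sm[X(w|_S)]`
(LST 2025, §2). Spelled as weighted homogeneity of weighted degree `blockProfile S` for the block
weight. [cite: LimayeSrinivasanTavenas2025, §2] -/
def IsSetMultilinear (blk : σ → ι) (S : Finset ι) (f : MvPolynomial σ R) : Prop :=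
  IsWeightedHomogeneous (blockWeight blk) f (blockProfile S)

/-- The *set-multilinear projection* onto the blocks `S`: the `R`-linear map keeping exactly the
monomials that are set-multilinear over `S` (LST 2025, proof of Lemma 12, p. 26:11: `α_S` is "the
projection of the polynomial computed by `α` to the set-multilinear part associated to `S`").
[cite: LimayeSrinivasanTavenas2025, Lemma 12] -/
def smlProj (blk : σ → ι) (S : Finset ι) : MvPolynomial σ R →ₗ[R] MvPolynomial σ R :=
  weightedHomogeneousComponent (blockWeight blk) (blockProfile S)

section Profile

/-- The weight of a single variable is the unit vector of its block. [folklore] -/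
@[simp]
theorem weight_blockWeight_single (blk : σ → ι) (v : σ) (n : ℕ) :
    weight (blockWeight blk) (Finsupp.single v n) = Finsupp.single (blk v) n := by
  rw [weight_single, blockWeight, smul_single, smul_eq_mul, mul_one]

/-- The block-degree vector is `Finsupp.mapDomain blk`. [folklore] -/
theorem weight_blockWeight_eq_mapDomain (blk : σ → ι) (m : σ →₀ ℕ) :
    weight (blockWeight blk) m = Finsupp.mapDomain blk m := by
  rw [weight_apply, Finsupp.mapDomain]
  refine Finsupp.sum_congr fun v _ => ?_
  rw [blockWeight, smul_single, smul_eq_mul, mul_one]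

/-- Entries of a block profile: `1` on `S`, `0` elsewhere. [folklore] -/
@[simp]
theorem blockProfile_apply [DecidableEq ι] (S : Finset ι) (i : ι) :
    blockProfile S i = if i ∈ S then 1 else 0 := by
  simp [blockProfile, Finsupp.finsetSum_apply, Finsupp.single_apply]

/-- The empty profile is `0`. [folklore] -/
@[simp]
theorem blockProfile_empty : blockProfile (∅ : Finset ι) = 0 := by
  simp [blockProfile]

/-- The support of a block profile is the set itself. [folklore] -/
@[simp]
theorem support_blockProfile (S : Finset ι) : (blockProfile S).support = S := by
  classical
  ext i
  simp [Finsupp.mem_support_iff]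

/-- Block profiles determine the set. [folklore] -/
theorem blockProfile_injective : Function.Injective (blockProfile : Finset ι → ι →₀ ℕ) := by
  intro S T h
  rw [← support_blockProfile S, h, support_blockProfile]

/-- A block profile vanishes only for the empty set. [folklore] -/
theorem blockProfile_eq_zero_iff (S : Finset ι) : blockProfile S = 0 ↔ S = ∅ := by
  rw [← blockProfile_empty]
  exact blockProfile_injective.eq_iff

/-- Profiles of disjoint unions add. [folklore] -/
theorem blockProfile_union [DecidableEq ι] {S T : Finset ι} (h : Disjoint S T) :
    blockProfile (S ∪ T) = blockProfile S + blockProfile T := by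
  ext i
  simp only [blockProfile_apply, Finset.mem_union, Finsupp.add_apply]
  by_cases hS : i ∈ S <;> by_cases hT : i ∈ T <;> simp [hS, hT]
  exact absurd (Finset.mem_inter.2 ⟨hS, hT⟩) (Finset.disjoint_iff_inter_eq_empty.1 h ▸ by simp)

/-- `blockProfile S₁ + blockProfile (S \ S₁) = blockProfile S` for `S₁ ⊆ S`. [folklore] -/
theorem blockProfile_add_sdiff [DecidableEq ι] {S S₁ : Finset ι} (h : S₁ ⊆ S) :
    blockProfile S₁ + blockProfile (S \ S₁) = blockProfile S := by
  rw [← blockProfile_union Finset.disjoint_sdiff, Finset.union_sdiff_of_subset h]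

/-- The singleton profile is a unit vector. [folklore] -/
@[simp]
theorem blockProfile_singleton (i : ι) : blockProfile ({i} : Finset ι) = Finsupp.single i 1 := by
  simp [blockProfile]

/-- **Unique splitting of profiles.** Two block-degree vectors add up to the profile of `S` iff
the first is the profile of its own support `S₁ ⊆ S` and the second is the profile of `S \ S₁`:
a set-multilinear monomial over `S` factors only as set-multilinear monomials over complementary
subsets (LST 2025, proof of Lemma 12). [cite: LimayeSrinivasanTavenas2025, Lemma 12] -/
theorem add_eq_blockProfile_iff [DecidableEq ι] (A B : ι →₀ ℕ) (S : Finset ι) :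
    A + B = blockProfile S ↔
      A.support ⊆ S ∧ A = blockProfile A.support ∧ B = blockProfile (S \ A.support) := by
  constructor
  · intro h
    have hpt : ∀ i, A i + B i = if i ∈ S then 1 else 0 := fun i => by
      have := DFunLike.congr_fun h i
      simpa using this
    have hA : ∀ i, A i ≤ 1 := fun i => by
      have := hpt i; split_ifs at this <;> omega
    refine ⟨fun i hi => ?_, ?_, ?_⟩
    · rw [Finsupp.mem_support_iff] at hi
      have := hpt i
      split_ifs at this with hiS
      · exact hiS
      · omega
    · ext i
      rw [blockProfile_apply]
      have := hA i
      by_cases hAi : A i = 0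
      · rw [if_neg (by simp [hAi])]; exact hAi
      · rw [if_pos (Finsupp.mem_support_iff.2 hAi)]; omega
    · ext i
      rw [blockProfile_apply]
      have h1 := hpt i
      have h2 := hA i
      by_cases hiS : i ∈ S
      · rw [if_pos hiS] at h1
        by_cases hAi : A i = 0
        · rw [if_pos (Finset.mem_sdiff.2 ⟨hiS, by simp [hAi]⟩)]; omega
        · rw [if_neg (fun h => (Finset.mem_sdiff.1 h).2 (Finsupp.mem_support_iff.2 hAi))]; omega
      · rw [if_neg hiS] at h1
        rw [if_neg (fun h => hiS (Finset.mem_sdiff.1 h).1)]; omega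
  · rintro ⟨hsub, hA, hB⟩
    rw [hA, hB]
    exact blockProfile_add_sdiff hsub

/-- Counting form of the unique splitting: among the subsets `S₁ ⊆ S`, exactly one satisfies
`A = blockProfile S₁ ∧ B = blockProfile (S \ S₁)` when `A + B = blockProfile S`, and none
otherwise. [cite: LimayeSrinivasanTavenas2025, Lemma 12] -/
theorem sum_powerset_ite_profile_split [DecidableEq ι] (A B : ι →₀ ℕ) (S : Finset ι) (c : R) :
    (∑ S₁ ∈ S.powerset, if A = blockProfile S₁ ∧ B = blockProfile (S \ S₁) then c else 0) =
      if A + B = blockProfile S then c else 0 := by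
  by_cases h : A + B = blockProfile S
  · rw [if_pos h]
    obtain ⟨hsub, hA, hB⟩ := (add_eq_blockProfile_iff A B S).1 h
    rw [Finset.sum_eq_single_of_mem A.support (Finset.mem_powerset.2 hsub)]
    · rw [if_pos ⟨hA, hB⟩]
    · intro S₁ _ hne
      rw [if_neg]
      rintro ⟨hA', -⟩
      apply hne
      rw [hA', support_blockProfile]
  · rw [if_neg h]
    refine Finset.sum_eq_zero fun S₁ hS₁ => ?_
    rw [if_neg]
    rintro ⟨hA', hB'⟩
    apply h
    rw [hA', hB', blockProfile_add_sdiff (Finset.mem_powerset.1 hS₁)]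

end Profile

/-! ### Set-multilinear projections -/

section Proj

variable (blk : σ → ι)

/-- Coefficients of the projection: the set-multilinear monomials over `S` are kept, all others
are dropped (LST 2025, Lemma 12). [cite: LimayeSrinivasanTavenas2025, Lemma 12] -/
theorem coeff_smlProj [DecidableEq ι] (S : Finset ι) (f : MvPolynomial σ R) (m : σ →₀ ℕ) :
    coeff m (smlProj blk S f) =
      if weight (blockWeight blk) m = blockProfile S then coeff m f else 0 := by
  unfold smlProj
  convert coeff_weightedHomogeneousComponent (w := blockWeight blk) (blockProfile S) f m

/-- The projection is set-multilinear over `S`. [cite: LimayeSrinivasanTavenas2025, Lemma 12] -/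
theorem isSetMultilinear_smlProj (S : Finset ι) (f : MvPolynomial σ R) :
    IsSetMultilinear blk S (smlProj blk S f) :=
  weightedHomogeneousComponent_isWeightedHomogeneous _ _

/-- A set-multilinear polynomial is its own projection. [cite: LimayeSrinivasanTavenas2025, §2] -/
theorem IsSetMultilinear.smlProj_eq {S : Finset ι} {f : MvPolynomial σ R}
    (hf : IsSetMultilinear blk S f) : smlProj blk S f = f :=
  hf.weightedHomogeneousComponent_same

/-- Projections of a set-multilinear polynomial: itself on its own block set, `0` elsewhere.
[cite: LimayeSrinivasanTavenas2025, §2] -/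
theorem IsSetMultilinear.smlProj_of_ne {S T : Finset ι} {f : MvPolynomial σ R}
    (hf : IsSetMultilinear blk T f) (h : S ≠ T) : smlProj blk S f = 0 :=
  hf.weightedHomogeneousComponent_ne _ fun h' => h (blockProfile_injective h')

/-- The projection is idempotent and the projections for different `S` are orthogonal.
[cite: LimayeSrinivasanTavenas2025, Lemma 12] -/
theorem smlProj_smlProj [DecidableEq ι] (S T : Finset ι) (f : MvPolynomial σ R) :
    smlProj blk S (smlProj blk T f) = if S = T then smlProj blk S f else 0 := by
  split_ifs with h
  · subst h
    exact (isSetMultilinear_smlProj blk S f).smlProj_eq blk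
  · exact (isSetMultilinear_smlProj blk T f).smlProj_of_ne blk h

/-- Sums of set-multilinear polynomials over the same blocks are set-multilinear.
[cite: LimayeSrinivasanTavenas2025, §2] -/
theorem IsSetMultilinear.add {S : Finset ι} {f g : MvPolynomial σ R}
    (hf : IsSetMultilinear blk S f) (hg : IsSetMultilinear blk S g) :
    IsSetMultilinear blk S (f + g) :=
  IsWeightedHomogeneous.add hf hg

/-- Scalar multiples of set-multilinear polynomials are set-multilinear.
[cite: LimayeSrinivasanTavenas2025, §2] -/
theorem IsSetMultilinear.smul {S : Finset ι} {f : MvPolynomial σ R}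
    (hf : IsSetMultilinear blk S f) (c : R) : IsSetMultilinear blk S (c • f) := by
  rw [smul_eq_C_mul]
  exact IsWeightedHomogeneous.C_mul hf c

/-- `0` is set-multilinear over any `S`. [folklore] -/
theorem isSetMultilinear_zero (S : Finset ι) : IsSetMultilinear blk S (0 : MvPolynomial σ R) :=
  isWeightedHomogeneous_zero R _ _

/-- Finite sums of set-multilinear polynomials over the same blocks are set-multilinear.
[cite: LimayeSrinivasanTavenas2025, §2] -/
theorem IsSetMultilinear.sum {κ : Type*} (s : Finset κ) {S : Finset ι}
    {f : κ → MvPolynomial σ R} (hf : ∀ j ∈ s, IsSetMultilinear blk S (f j)) :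
    IsSetMultilinear blk S (∑ j ∈ s, f j) :=
  IsWeightedHomogeneous.sum s f _ hf

/-- **Products of set-multilinear polynomials over disjoint block sets are set-multilinear over
the union** (LST 2025, §2.1, Claim 7(3): "as the product is set-multilinear").
[cite: LimayeSrinivasanTavenas2025, Claim 7] -/
theorem IsSetMultilinear.mul [DecidableEq ι] {S T : Finset ι} {f g : MvPolynomial σ R}
    (hf : IsSetMultilinear blk S f) (hg : IsSetMultilinear blk T g) (h : Disjoint S T) :
    IsSetMultilinear blk (S ∪ T) (f * g) := by
  unfold IsSetMultilinear
  rw [blockProfile_union h]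
  exact IsWeightedHomogeneous.mul hf hg

/-- Constants are set-multilinear over the empty block set. [folklore] -/
theorem isSetMultilinear_C (c : R) : IsSetMultilinear blk ∅ (C c : MvPolynomial σ R) := by
  unfold IsSetMultilinear
  rw [blockProfile_empty]
  exact isWeightedHomogeneous_C _ c

/-- A variable is set-multilinear over its own block. [folklore] -/
theorem isSetMultilinear_X (v : σ) : IsSetMultilinear blk {blk v} (X v : MvPolynomial σ R) := by
  unfold IsSetMultilinear
  rw [blockProfile_singleton]
  have := isWeightedHomogeneous_X R (blockWeight blk) v
  rwa [blockWeight] at this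

/-- Projections of a constant: the constant itself for `S = ∅`, zero otherwise. [folklore] -/
theorem smlProj_C [DecidableEq ι] (S : Finset ι) (c : R) :
    smlProj blk S (C c : MvPolynomial σ R) = if S = ∅ then C c else 0 := by
  by_cases h : S = ∅
  · rw [if_pos h, h]
    exact (isSetMultilinear_C blk c).smlProj_eq blk
  · rw [if_neg h]
    exact (isSetMultilinear_C blk c).smlProj_of_ne blk h

/-- Projections of a variable: the variable itself for `S = {blk v}`, zero otherwise. [folklore] -/
theorem smlProj_X [DecidableEq ι] (S : Finset ι) (v : σ) :
    smlProj blk S (X v : MvPolynomial σ R) = if S = {blk v} then X v else 0 := by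
  by_cases h : S = {blk v}
  · rw [if_pos h, h]
    exact (isSetMultilinear_X blk v).smlProj_eq blk
  · rw [if_neg h]
    exact (isSetMultilinear_X blk v).smlProj_of_ne blk h

/-- The projection onto the empty block set is the constant term. [folklore] -/
theorem smlProj_empty (f : MvPolynomial σ R) : smlProj blk ∅ f = C (coeff 0 f) := by
  unfold smlProj
  rw [blockProfile_empty]
  exact weightedHomogeneousComponent_zero f fun v => Finsupp.single_ne_zero.2 one_ne_zero

/-- **Product formula** (the identity behind LST 2025, Lemma 12, p. 26:11,
`α_S = ∑_{(S_1,…,S_p) partition of S} α_1^{S_1} ⋯ α_p^{S_p}`, binary case): the set-multilinear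
part over `S` of a product is the sum over `S₁ ⊆ S` of the products of the parts over `S₁` and
over `S \ S₁`. [cite: LimayeSrinivasanTavenas2025, Lemma 12] -/
theorem smlProj_mul [DecidableEq ι] (S : Finset ι) (f g : MvPolynomial σ R) :
    smlProj blk S (f * g) = ∑ S₁ ∈ S.powerset, smlProj blk S₁ f * smlProj blk (S \ S₁) g := by
  classical
  ext m
  rw [coeff_smlProj, coeff_sum]
  simp_rw [coeff_mul, coeff_smlProj]
  rw [Finset.sum_comm]
  have key : ∀ x ∈ Finset.antidiagonal m,
      (∑ S₁ ∈ S.powerset,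
        (if weight (blockWeight blk) x.1 = blockProfile S₁ then coeff x.1 f else 0) *
          (if weight (blockWeight blk) x.2 = blockProfile (S \ S₁) then coeff x.2 g else 0)) =
      if weight (blockWeight blk) m = blockProfile S then coeff x.1 f * coeff x.2 g else 0 := by
    intro x hx
    have hx' : x.1 + x.2 = m := Finset.mem_antidiagonal.1 hx
    rw [← hx', map_add, ← sum_powerset_ite_profile_split]
    refine Finset.sum_congr rfl fun S₁ _ => ?_
    by_cases h1 : weight (blockWeight blk) x.1 = blockProfile S₁ <;>
      by_cases h2 : weight (blockWeight blk) x.2 = blockProfile (S \ S₁) <;> simp [h1, h2]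
  rw [Finset.sum_congr rfl key]
  split_ifs with h
  · rfl
  · exact Finset.sum_const_zero.symm

/-- Product formula for two set-multilinear-free factors, `IsSetMultilinear` form: the product of
a polynomial set-multilinear over `S₁` and one over a disjoint `S₂` has projection onto `S₁ ∪ S₂`
equal to the product. [cite: LimayeSrinivasanTavenas2025, Claim 7] -/
theorem smlProj_mul_of_isSetMultilinear [DecidableEq ι] {S T : Finset ι} {f g : MvPolynomial σ R}
    (hf : IsSetMultilinear blk S f) (hg : IsSetMultilinear blk T g) (h : Disjoint S T) :
    smlProj blk (S ∪ T) (f * g) = f * g :=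
  (hf.mul blk hg h).smlProj_eq blk

end Proj

/-! ### The `n`-ary product formula (span form) and vanishing -/

section NAry

variable (blk : σ → ι)

/-- The `q`-th part of the labelled ordered partition of `S` encoded by a map `a : ↥S → Fin n`:
the elements of `S` sent to `q`. [folklore] -/
def blockPart (S : Finset ι) {n : ℕ} (a : S → Fin n) (q : Fin n) : Finset ι :=
  (Finset.univ.filter fun x : S => a x = q).map (Function.Embedding.subtype _)

/-- Membership in a part. [folklore] -/
theorem mem_blockPart {S : Finset ι} {n : ℕ} (a : S → Fin n) (q : Fin n) (i : ι) :
    i ∈ blockPart S a q ↔ ∃ h : i ∈ S, a ⟨i, h⟩ = q := by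
  simp [blockPart]

/-- Parts are contained in `S`. [folklore] -/
theorem blockPart_subset {S : Finset ι} {n : ℕ} (a : S → Fin n) (q : Fin n) : blockPart S a q ⊆ S :=
  fun i hi => ((mem_blockPart a q i).1 hi).1

/-- Distinct parts are disjoint. [folklore] -/
theorem disjoint_blockPart {S : Finset ι} {n : ℕ} (a : S → Fin n) {q q' : Fin n} (h : q ≠ q') :
    Disjoint (blockPart S a q) (blockPart S a q') := by
  rw [Finset.disjoint_left]
  intro i hi hi'
  obtain ⟨h1, h1'⟩ := (mem_blockPart a q i).1 hi
  obtain ⟨h2, h2'⟩ := (mem_blockPart a q' i).1 hi'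
  exact h (h1'.symm.trans h2')

/-- The parts cover `S`. [folklore] -/
theorem biUnion_blockPart [DecidableEq ι] {S : Finset ι} {n : ℕ} (a : S → Fin n) :
    (Finset.univ : Finset (Fin n)).biUnion (blockPart S a) = S := by
  ext i
  simp only [Finset.mem_biUnion, Finset.mem_univ, true_and, mem_blockPart]
  exact ⟨fun ⟨_, h, _⟩ => h, fun h => ⟨a ⟨i, h⟩, h, rfl⟩⟩

/-- The sizes of the parts add up to `#S`. [folklore] -/
theorem sum_card_blockPart {S : Finset ι} {n : ℕ} (a : S → Fin n) :
    ∑ q, (blockPart S a q).card = S.card := by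
  classical
  rw [← Finset.card_biUnion fun q _ q' _ h => disjoint_blockPart a h, biUnion_blockPart]

/-- The generators of the `n`-ary product formula: for a list of factors `L` and a labelled
ordered partition `a` of `S` into `L.length` parts, the product of the projections of the factors
onto their parts (LST 2025, Lemma 12: the summands `α_1^{S_1} ⋯ α_p^{S_p}`).
[cite: LimayeSrinivasanTavenas2025, Lemma 12] -/
def partProd (S : Finset ι) (L : List (MvPolynomial σ R)) (a : S → Fin L.length) :
    MvPolynomial σ R :=
  ∏ q : Fin L.length, smlProj blk (blockPart S a q) L[q]

/-- Each generator of the `n`-ary product formula is set-multilinear over `S`.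
[cite: LimayeSrinivasanTavenas2025, Lemma 12] -/
theorem isSetMultilinear_partProd (S : Finset ι) (L : List (MvPolynomial σ R))
    (a : S → Fin L.length) : IsSetMultilinear blk S (partProd blk S L a) := by
  classical
  unfold partProd IsSetMultilinear
  have h := IsWeightedHomogeneous.prod (w := blockWeight blk) Finset.univ
    (fun q : Fin L.length => smlProj blk (blockPart S a q) L[q])
    (fun q => blockProfile (blockPart S a q))
    (fun q _ => isSetMultilinear_smlProj blk _ _)
  convert h using 1
  unfold blockProfile
  rw [← Finset.sum_biUnion fun q _ q' _ h => disjoint_blockPart a h, biUnion_blockPart]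

/-- **`n`-ary product formula, span form** (LST 2025, Lemma 12, p. 26:11: for a product gate
`α = α_1 ⋯ α_p`, `α_S = ∑_{(S_1, …, S_p) partition of S} α_1^{S_1} ⋯ α_p^{S_p}`): the
set-multilinear part over `S` of the product of a list `L` of polynomials lies in the `R`-span of
the `L.length ^ #S` products `∏_q smlProj (blockPart S a q) L[q]`, `a : ↥S → Fin L.length`.
[cite: LimayeSrinivasanTavenas2025, Lemma 12] -/
theorem smlProj_list_prod_mem_span (S : Finset ι) (L : List (MvPolynomial σ R)) :
    smlProj blk S L.prod ∈ Submodule.span R (Set.range (partProd blk S L)) := by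
  classical
  induction L generalizing S with
  | nil =>
    rw [List.prod_nil, ← C_1, smlProj_C]
    split_ifs with hS
    · subst hS
      refine Submodule.subset_span ⟨fun x => (Finset.notMem_empty _ x.2).elim, ?_⟩
      simp [partProd]
    · exact Submodule.zero_mem _
  | cons f L ih =>
    rw [List.prod_cons, smlProj_mul]
    refine Submodule.sum_mem _ fun S₁ hS₁ => ?_
    have hS₁S : S₁ ⊆ S := Finset.mem_powerset.1 hS₁
    -- push the first factor inside the span of the generators for `L` on `S \ S₁`
    have hmul : smlProj blk S₁ f * smlProj blk (S \ S₁) L.prod ∈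
        Submodule.span R (LinearMap.mulLeft R (smlProj blk S₁ f) ''
          Set.range (partProd blk (S \ S₁) L)) := by
      rw [← Submodule.map_span]
      exact Submodule.mem_map_of_mem (ih (S \ S₁))
    refine Submodule.span_mono ?_ hmul
    rintro _ ⟨_, ⟨a, rfl⟩, rfl⟩
    -- the extended labelled partition: `S₁ ↦ 0`, the rest as in `a`, shifted by one
    let a' : S → Fin (L.length + 1) := fun x =>
      if hx : (x : ι) ∈ S₁ then 0
      else Fin.succ (a ⟨x, Finset.mem_sdiff.2 ⟨x.2, hx⟩⟩)
    refine ⟨a', ?_⟩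
    have h0 : blockPart S a' 0 = S₁ := by
      ext i
      rw [mem_blockPart]
      constructor
      · rintro ⟨hi, h⟩
        by_contra hiS₁
        simp [a', hiS₁, Fin.succ_ne_zero] at h
      · intro hi
        exact ⟨hS₁S hi, by simp [a', hi]⟩
    have hsucc : ∀ q : Fin L.length, blockPart S a' q.succ = blockPart (S \ S₁) a q := by
      intro q
      ext i
      rw [mem_blockPart, mem_blockPart]
      constructor
      · rintro ⟨hi, h⟩
        by_cases hiS₁ : i ∈ S₁
        · simp only [a', hiS₁, dite_true] at h
          exact absurd h.symm (Fin.succ_ne_zero q)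
        · refine ⟨Finset.mem_sdiff.2 ⟨hi, hiS₁⟩, ?_⟩
          simpa [a', hiS₁, Fin.succ_inj] using h
      · rintro ⟨hi, h⟩
        obtain ⟨hiS, hiS₁⟩ := Finset.mem_sdiff.1 hi
        exact ⟨hiS, by simp [a', hiS₁, h]⟩
    change ∏ q : Fin (L.length + 1), smlProj blk (blockPart S a' q) (f :: L)[(q : ℕ)] =
      LinearMap.mulLeft R (smlProj blk S₁ f) (partProd blk (S \ S₁) L a)
    rw [LinearMap.mulLeft_apply, Fin.prod_univ_succ, partProd]
    congr 1
    · rw [h0]; rfl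
    · exact Finset.prod_congr rfl fun q _ => by rw [hsucc]; rfl

/-- Span form of the product formula with explicit coefficients: the projection of a list
product is an `R`-linear combination of the generators `partProd`.
[cite: LimayeSrinivasanTavenas2025, Lemma 12] -/
theorem exists_smlProj_list_prod_eq_sum [DecidableEq ι] (S : Finset ι)
    (L : List (MvPolynomial σ R)) :
    ∃ c : (S → Fin L.length) → R, smlProj blk S L.prod = ∑ a, c a • partProd blk S L a := by
  obtain ⟨c, hc⟩ := (Submodule.mem_span_range_iff_exists_fun R).1
    (smlProj_list_prod_mem_span blk S L)
  exact ⟨c, hc.symm⟩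

/-- A polynomial without constant term has vanishing projection onto the empty block set.
[folklore] -/
theorem smlProj_empty_eq_zero {f : MvPolynomial σ R} (hf : coeff 0 f = 0) :
    smlProj blk ∅ f = 0 := by
  rw [smlProj_empty, hf, C_0]

/-- **Vanishing on long products of constant-free factors**: if every factor of `L` has zero
constant term and `L` has more than `#S` factors, then the set-multilinear part over `S` of the
product vanishes — in every labelled partition of `S` into `L.length` parts some part is empty
(pigeonhole), and the corresponding factor projects to its constant term `0`. (Used as: in a
homogeneous-components bookkeeping modulo degree `> d`, products of more than `d` constant-free
factors are negligible; LST 2025, §7, proof of Lemma 20, "if there are more than `d` many `j`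
such that `c_j = 0`, then `T^{(d)}` … is the zero polynomial".)
[cite: LimayeSrinivasanTavenas2025, Lemma 20] -/
theorem smlProj_list_prod_eq_zero_of_card_lt (S : Finset ι) (L : List (MvPolynomial σ R))
    (hL : ∀ f ∈ L, coeff 0 f = 0) (hcard : S.card < L.length) : smlProj blk S L.prod = 0 := by
  classical
  obtain ⟨c, hc⟩ := exists_smlProj_list_prod_eq_sum blk S L
  rw [hc]
  refine Finset.sum_eq_zero fun a _ => ?_
  -- some part of `a` is empty
  have hex : ∃ q : Fin L.length, blockPart S a q = ∅ := by
    by_contra hne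
    simp only [not_exists] at hne
    have h1 : ∀ q : Fin L.length, 1 ≤ (blockPart S a q).card := fun q =>
      Finset.card_pos.2 (Finset.nonempty_iff_ne_empty.2 (hne q))
    have := Finset.sum_le_sum fun q (_ : q ∈ Finset.univ) => h1 q
    rw [sum_card_blockPart, Finset.sum_const, Finset.card_univ, Fintype.card_fin, smul_eq_mul,
      mul_one] at this
    omega
  obtain ⟨q, hq⟩ := hex
  have hzero : smlProj blk (blockPart S a q) L[q] = 0 := by
    rw [hq]
    exact smlProj_empty_eq_zero blk (hL _ (List.getElem_mem _))
  rw [partProd, Finset.prod_eq_zero (Finset.mem_univ q) hzero, smul_zero]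

/-- Powers: the set-multilinear part over `S` of `f ^ n` lies in the span of the products
`∏_q smlProj (blockPart S a q) f` over labelled partitions `a : ↥S → Fin n`.
[cite: LimayeSrinivasanTavenas2025, Lemma 12] -/
theorem smlProj_pow_mem_span (S : Finset ι) (f : MvPolynomial σ R) (n : ℕ) :
    smlProj blk S (f ^ n) ∈ Submodule.span R
      (Set.range fun a : S → Fin n => ∏ q : Fin n, smlProj blk (blockPart S a q) f) := by
  have h := smlProj_list_prod_mem_span blk S (List.replicate n f)
  rw [List.prod_replicate] at h
  have hlen : (List.replicate n f).length = n := List.length_replicate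
  -- transport the generators along `Fin (replicate n f).length = Fin n`
  refine Submodule.span_mono ?_ h
  rintro _ ⟨a, rfl⟩
  refine ⟨fun x => Fin.cast hlen (a x), ?_⟩
  unfold partProd
  refine (Fintype.prod_equiv (finCongr hlen)
    (fun q => smlProj blk (blockPart S a q) (List.replicate n f)[(q : ℕ)])
    (fun q => smlProj blk (blockPart S (fun x => Fin.cast hlen (a x)) q) f) fun q => ?_).symm
  have hp : blockPart S (fun x => Fin.cast hlen (a x)) (finCongr hlen q) = blockPart S a q := by
    ext i
    simp only [mem_blockPart, finCongr_apply]
    exact ⟨fun ⟨h, h'⟩ => ⟨h, Fin.cast_injective _ h'⟩, fun ⟨h, h'⟩ => ⟨h, by rw [h']⟩⟩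
  rw [hp, List.getElem_replicate]

/-- A power `f ^ n` of a constant-free polynomial has no set-multilinear part over fewer than `n`
blocks. [cite: LimayeSrinivasanTavenas2025, Lemma 20] -/
theorem smlProj_pow_eq_zero_of_card_lt (S : Finset ι) {f : MvPolynomial σ R} (hf : coeff 0 f = 0)
    {n : ℕ} (h : S.card < n) : smlProj blk S (f ^ n) = 0 := by
  have := smlProj_list_prod_eq_zero_of_card_lt blk S (List.replicate n f)
    (fun g hg => by rw [List.eq_of_mem_replicate hg]; exact hf) (by simpa using h)
  rwa [List.prod_replicate] at this

end NAry

/-! ### Block-preserving substitutions commute with the projections -/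

section Subst

variable {τ : Type*}

/-- A substitution is *block-preserving* (for block maps `blk` on the source and `blk'` on the
target variables) if it sends every variable `v` to a polynomial that is block-linear in the block
`blk v`: all its monomials consist of a single variable of block `blk v` (e.g. a variable of that
block, a linear form in such variables, or `0`). These are the "set-multilinear restrictions"
`ρ_p : X_p → X(w_p)` of LST 2025, §8 (proof of Lemma 8), extended linearly.
[cite: LimayeSrinivasanTavenas2025, Lemma 8] -/
def IsBlockPreserving (blk : σ → ι) (blk' : τ → ι) (g : σ → MvPolynomial τ R) : Prop :=
  ∀ v, IsWeightedHomogeneous (blockWeight blk') (g v) (Finsupp.single (blk v) 1)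

/-- A block-preserving substitution maps monomials of block-degree vector `β` to polynomials all of
whose monomials have block-degree vector `β`. [cite: LimayeSrinivasanTavenas2025, Lemma 8] -/
theorem IsBlockPreserving.aeval_monomial {blk : σ → ι} {blk' : τ → ι}
    {g : σ → MvPolynomial τ R} (hg : IsBlockPreserving blk blk' g) (m : σ →₀ ℕ) (r : R) :
    IsWeightedHomogeneous (blockWeight blk') (aeval g (monomial m r))
      (weight (blockWeight blk) m) := by
  rw [MvPolynomial.aeval_monomial, Finsupp.prod, weight_apply, Finsupp.sum]
  refine IsWeightedHomogeneous.C_mul ?_ r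
  refine IsWeightedHomogeneous.prod _ _ _ fun v _ => ?_
  exact (hg v).pow (m v)

/-- **Block-preserving substitutions commute with set-multilinear projection**: if `g` sends each
variable to a block-linear form of its own block, then
`smlProj blk' S (aeval g f) = aeval g (smlProj blk S f)` for every `S` — a set-multilinear
monomial stays set-multilinear over the same blocks (or dies), a non-set-multilinear one stays
non-set-multilinear (or dies) (LST 2025, §8, proof of Lemma 8: applying the substitutions `ρ_p`
to a set-multilinear circuit "directly" gives a set-multilinear circuit).
[cite: LimayeSrinivasanTavenas2025, Lemma 8] -/
theorem IsBlockPreserving.smlProj_aeval {blk : σ → ι} {blk' : τ → ι}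
    {g : σ → MvPolynomial τ R} (hg : IsBlockPreserving blk blk' g) (S : Finset ι)
    (f : MvPolynomial σ R) :
    smlProj blk' S (aeval g f) = aeval g (smlProj blk S f) := by
  classical
  induction f using MvPolynomial.induction_on' with
  | monomial m r =>
    have hm := hg.aeval_monomial m r
    unfold smlProj
    rw [weightedHomogeneousComponent_of_mem hm,
      weightedHomogeneousComponent_of_mem (isWeightedHomogeneous_monomial _ m r rfl)]
    split_ifs <;> simp
  | add p q hp hq => simp only [map_add, hp, hq]

/-- A block-preserving substitution maps set-multilinear polynomials over `S` to set-multilinear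
polynomials over `S`. [cite: LimayeSrinivasanTavenas2025, Lemma 8] -/
theorem IsBlockPreserving.isSetMultilinear_aeval {blk : σ → ι} {blk' : τ → ι}
    {g : σ → MvPolynomial τ R} (hg : IsBlockPreserving blk blk' g) {S : Finset ι}
    {f : MvPolynomial σ R} (hf : IsSetMultilinear blk S f) :
    IsSetMultilinear blk' S (aeval g f) := by
  have h := hg.smlProj_aeval S f
  rw [hf.smlProj_eq] at h
  rw [← h]
  exact isSetMultilinear_smlProj blk' S _

/-- Renaming variables along a block-compatible map (`blk' ∘ e = blk`) is block-preserving.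
[folklore] -/
theorem isBlockPreserving_X_comp {blk : σ → ι} {blk' : τ → ι} (e : σ → τ)
    (he : ∀ v, blk' (e v) = blk v) :
    IsBlockPreserving blk blk' (fun v => (X (e v) : MvPolynomial τ R)) := by
  intro v
  have := isWeightedHomogeneous_X R (blockWeight blk') (e v)
  rwa [blockWeight, he] at this

/-- Sending a variable either to a variable of the same block or to `0` is block-preserving (the
shape of the restrictions `ρ_p` of LST 2025, Lemma 8 / Lemma 22, whose edge labels are single
variables or `0`). [cite: LimayeSrinivasanTavenas2025, Lemma 22] -/
theorem isBlockPreserving_option {blk : σ → ι} {blk' : τ → ι} (e : σ → Option τ)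
    (he : ∀ v u, e v = some u → blk' u = blk v) :
    IsBlockPreserving blk blk' (fun v => ((e v).elim 0 X : MvPolynomial τ R)) := by
  intro v
  dsimp only
  cases h : e v with
  | none =>
    simpa using isWeightedHomogeneous_zero R (blockWeight blk') (Finsupp.single (blk v) 1)
  | some u =>
    have := isWeightedHomogeneous_X R (blockWeight blk') u
    rw [blockWeight, he v u h] at this
    simpa using this

end Subst

end Literature.Computability.AlgebraicComplexity
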